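import Summits.Ventures.QEC.CircuitDistance.ETowerData345X
import Summits.Ventures.QEC.CircuitDistance.ETowerDP
import HarnessLib

/-!
# #345 E-fold tower (`[[144,12,12]]` under CNOT order #345, W = 10), sector X: the BASE KERNEL-WORD COUNTS `N_w` by the in-kernel
# weight-enumerator DP (cell `qec`, experiment CDX; seat qec-cdx-type-2 g1; the #345 twin of type-1's `ETowerCountX`, STEP2-ASSEMBLY-SPEC §B9)

`dpX`: ONE `decide +kernel` run of `ETowerDP.dpCount` over the 45 extended base columns `tab TE3 15` (landed `ETowerData345X`, = idea-1's
`Ident345X.T33`): the numbers of kernel words of `E₃ = E(3,3)·5` by weight `0 … 10` (= idea-1's S-form emission count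
`[1, 0, 0, 39, 126, 603, 3945, 21618, 103887, 432155, 1559673]`, EMISSION-S-FORM.md).  `card_Xw_345X`: hence `#(Xw (tab TE3 15) 3 3 5 w)` for
`w ≤ 10` — the `hcount` input of `ETowerBase.base_of_slices`; `NW` is the target of eng-1's base-slice orbit-size sums (`hBsum`).
No `native_decide`; nothing here asserts a value of `d_circ`.
-/

set_option maxRecDepth 100000

namespace Summit.Ventures.QEC.CircuitDistance.ETower.Sec345X

open Summit.Ventures.QEC.Census Summit.Ventures.QEC.Census.Fold Summit.Ventures.QEC.CircuitDistance.ETower Finset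

/-- The base counts `N_w`, `w = 0 … 10`, of the #345 X tower (DATA, checked by `dpX`). -/
def NW : List ℕ := [1, 0, 0, 39, 126, 603, 3945, 21618, 103887, 432155, 1559673]

set_option maxHeartbeats 4000000000 in
/-- KERNEL: the weight-enumerator DP over the 45 base columns of `E(#345)` returns `NW` (weights `0 … 10`). -/
theorem dpX : (List.range 11).map (dpCount (tab TE3 15) 45 15 10) = NW := by decide +kernel

/-- KERNEL: the base columns of `E(#345)` are 15-bit (pointwise form). -/
theorem te3_lt345 : ∀ i, i < 45 → tab TE3 15 i < 2 ^ 15 := by decide +kernel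

/-- **The number of base kernel words of weight `w ≤ 10` is `NW[w]`** (#345, sector X). -/
theorem card_Xw_345X {w : ℕ} (hw : w ≤ 10) : #(Xw (tab TE3 15) 3 3 5 w) = NW.getD w 0 := by
  rw [Xw_eq_Xw', show 5 * (3 * 3) = 45 from rfl, ← dpCount_eq_card (tab TE3 15) (d := 15) (W := 10) (by norm_num) te3_lt345 hw]
  have h := dpX
  have hwl : w < 11 := by omega
  have := congrArg (fun l => l.getD w 0) h
  rw [List.getD_eq_getElem _ _ (by rw [List.length_map, List.length_range]; exact hwl), List.getElem_map, List.getElem_range] at this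
  exact this

end Summit.Ventures.QEC.CircuitDistance.ETower.Sec345X
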